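/-
Copyright (c) 2026. All rights reserved.
Released under Apache 2.0 license as described in the file LICENSE.
Authors: abc-iut cell, campaign-S prover seat abc-iut-S1 (wave 1).
-/
import Literature.IUT.LogVolume.LogSeriesEstimates
import Literature.IUT.LogVolume.RamificationInvariants
import HarnessLib

/-!
# [IUTchIV] Proposition 1.2 (i): `p^a · R ⊆ log_p(R^×) ⊆ p^{-b} · R`

Mochizuki, *Inter-universal Teichmüller theory IV*, RIMS manuscript (Apr. 2020), §1, Proposition 1.2
"(Differents and Logarithms)", part (i), kurims p. 10, with its proof p. 11 ll. 10–12: "Since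
`a_i > 1/(p−1)`, `p^{b_i + 1/e_i} > e_i/(p−1)` [cf. the definition of `⌈−⌉`, `⌊−⌋`!], assertion (i)
follows immediately from the well-known theory of the `p`-adic logarithm and exponential maps [cf.,
e.g., [Kobl], p. 81]."  Statement as printed: for a finite extension `k_i` of `ℚ_p` with ring of
integers `R_i`, ramification index `e_i`, `a_i := (1/e_i)·⌈e_i/(p−2)⌉` (`p > 2`), `a_i := 2` (`p = 2`),
`b_i := ⌊log(p·e_i/(p−1))/log(p)⌋ − 1/e_i`:

  (i) We have: `p^{a_i} · R_i ⊆ log_p(R_i^×) ⊆ p^{−b_i} · R_i` — where the "⊆'s" are equalities when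
  `p > 2` and `e_i ≤ p − 2`.

## What is here

* `Prop12i p K` — the statement, typed over `LocalUnitLog.lean` (`logUnits K = log_p(R^×)`) and
  `RamificationInvariants.lean` (`pBall p K λ = p^λ · R`, `absRamificationIdx`, `logRadiusA/B`), and
  `Prop12iEq p K` — the equality clause; both PROVED (`prop12i_holds`, `prop12iEq_holds`).
* The proof does not use the exponential: the lower inclusion `p^a·R ⊆ log_p(R^×)` is obtained by
  successive approximation inside the complete group `1 + p^a·R` (`LogSeriesEstimates.lean`:
  `exists_logSeries_eq` — for `‖z‖ ≤ ρ` with `θ := ρ·p^{1/(p−1)} < 1` there is `u`, `‖1 − u‖ ≤ ρ`,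
  `L(u) = z`; the contraction `‖L(y) + (1−y)‖ ≤ θ·‖1−y‖` is where the text's `a_i > 1/(p−1)` enters,
  `one_div_lt_logRadiusA`); the upper inclusion uses a principal-unit power `u^m` with `p ∤ m` and the
  term estimate `‖(1−y)^N/N‖ ≤ p^{v_p(N) − N/e} ≤ p^{b}` (`padicValNat_sub_le`, i.e. the text's
  `p^{b_i+1/e_i} > e_i/(p−1)`, `lt_pow_floor_mul`).
* `unitLog_image_eq_pBall`, `unitLog_injOn` — `log_p : 1 + p^a·R → p^a·R` is a bijection.

Classical and undisputed (Koblitz, *p-adic Numbers, p-adic Analysis, and Zeta-Functions*, Ch. IV §1–2;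
Neukirch ANT II (5.5)); the tag form [claim: Mochizuki2012, status: disputed] records that the STATEMENT
is transcribed from [IUTchIV].
-/

noncomputable section

open Filter Metric Finset
open _root_.Topology
open IsUltrametricDist

namespace Literature.IUT.LogVolume

open Literature.NumberTheory.Transcendental

variable (p : ℕ) [Fact p.Prime]
variable (K : Type*) [NontriviallyNormedField K] [instK : NormedAlgebra ℚ_[p] K]

/-! ## The statement -/

/-- **[IUTchIV] Proposition 1.2 (i)** (kurims p. 10): with `e` the ramification index of `K/ℚ_p`,
`a = logRadiusA p e`, `b = logRadiusB p e`:  `p^a · R ⊆ log_p(R^×) ⊆ p^{−b} · R`.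
[claim: Mochizuki2012, status: disputed] -/
def Prop12i [IsUltrametricDist K] [ProperSpace K] : Prop :=
  pBall p K (logRadiusA p (absRamificationIdx p K)) ⊆ logUnits K ∧
    logUnits K ⊆ pBall p K (-logRadiusB p (absRamificationIdx p K))

/-- **[IUTchIV] Proposition 1.2 (i), equality clause** (kurims p. 10): "the `⊆`'s are equalities when
`p > 2` and `e_i ≤ p − 2`". [claim: Mochizuki2012, status: disputed] -/
def Prop12iEq [IsUltrametricDist K] [ProperSpace K] : Prop :=
  2 < p → absRamificationIdx p K ≤ p - 2 →
    pBall p K (logRadiusA p (absRamificationIdx p K)) = logUnits K ∧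
      logUnits K = pBall p K (-logRadiusB p (absRamificationIdx p K))

/-! ## Arithmetic of the exponents ("`a_i > 1/(p−1)`, `p^{b_i+1/e_i} > e_i/(p−1)`", p. 11) -/
omit instK in
/-- "`a_i > 1/(p−1)`" (p. 11): for `e ≥ 1`, `1/(p−1) < a`. [claim: Mochizuki2012, status: disputed] -/
theorem one_div_lt_logRadiusA {e : ℕ} (he : 1 ≤ e) : 1 / ((p : ℝ) - 1) < logRadiusA p e := by
  have hp : p.Prime := Fact.out
  have hp2 : (2 : ℝ) ≤ p := by exact_mod_cast hp.two_le
  unfold logRadiusA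
  split_ifs with h2
  · subst h2; norm_num
  · have hp3 : 3 ≤ p := by
      have := hp.two_le; omega
    have hp3' : (3 : ℝ) ≤ p := by exact_mod_cast hp3
    have he' : (0 : ℝ) < e := by exact_mod_cast he
    have h1 : (e : ℝ) / ((p : ℝ) - 2) ≤ ⌈(e : ℝ) / ((p : ℝ) - 2)⌉ := Int.le_ceil _
    calc 1 / ((p : ℝ) - 1) < 1 / ((p : ℝ) - 2) := by
          apply one_div_lt_one_div_of_lt <;> linarith
      _ = ((e : ℝ) / ((p : ℝ) - 2)) / e := by field_simp
      _ ≤ (⌈(e : ℝ) / ((p : ℝ) - 2)⌉ : ℝ) / e := by gcongr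

omit instK in
/-- The integer `c := ⌊log(p·e/(p−1))/log(p)⌋` (so `b = c − 1/e`) is `≥ 0` for `e ≥ 1`.
[claim: Mochizuki2012, status: disputed] -/
theorem floor_logRadius_nonneg {e : ℕ} (he : 1 ≤ e) :
    0 ≤ ⌊Real.log ((p : ℝ) * e / ((p : ℝ) - 1)) / Real.log p⌋ := by
  have hp1 : (1 : ℝ) < p := by exact_mod_cast (Fact.out : p.Prime).one_lt
  have he' : (1 : ℝ) ≤ e := by exact_mod_cast he
  refine Int.floor_nonneg.mpr (div_nonneg (Real.log_nonneg ?_) (Real.log_pos hp1).le)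
  rw [le_div_iff₀ (by linarith)]
  nlinarith

omit instK in
/-- "`p^{b_i+1/e_i} > e_i/(p−1)`" (p. 11): with `c = ⌊log(p·e/(p−1))/log(p)⌋`, `e < p^c·(p−1)`.
[claim: Mochizuki2012, status: disputed] -/
theorem lt_pow_floor_mul {e : ℕ} (he : 1 ≤ e) :
    (e : ℝ) < (p : ℝ) ^ (⌊Real.log ((p : ℝ) * e / ((p : ℝ) - 1)) / Real.log p⌋).toNat * ((p : ℝ) - 1) := by
  have hp1 : (1 : ℝ) < p := by exact_mod_cast (Fact.out : p.Prime).one_lt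
  have hp0 : (0 : ℝ) < p := by linarith
  have he' : (1 : ℝ) ≤ e := by exact_mod_cast he
  set x : ℝ := (p : ℝ) * e / ((p : ℝ) - 1) with hx
  have hx0 : 0 < x := by rw [hx]; exact div_pos (by nlinarith) (by linarith)
  set c := ⌊Real.log x / Real.log p⌋ with hc
  have hc0 : 0 ≤ c := floor_logRadius_nonneg p he
  have hlogp : 0 < Real.log p := Real.log_pos hp1
  -- `log x / log p < c + 1`, so `x < p^(c+1)`
  have h1 : Real.log x < ((c.toNat + 1 : ℕ) : ℝ) * Real.log p := by
    have := Int.lt_floor_add_one (Real.log x / Real.log p)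
    rw [← hc, div_lt_iff₀ hlogp] at this
    have hcc : ((c.toNat : ℕ) : ℝ) = (c : ℝ) := by exact_mod_cast Int.toNat_of_nonneg hc0
    push_cast
    rw [hcc]
    exact this
  have h2 : x < (p : ℝ) ^ (c.toNat + 1) := by
    rw [← Real.log_lt_log_iff hx0 (by positivity), Real.log_pow]
    exact h1
  rw [hx, div_lt_iff₀ (by linarith), pow_succ] at h2
  -- `p * e < p^c * p * (p - 1)` ⇒ `e < p^c * (p - 1)`
  have h3 : (p : ℝ) * e < (p : ℝ) * ((p : ℝ) ^ c.toNat * ((p : ℝ) - 1)) := by linarith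
  exact lt_of_mul_lt_mul_left h3 hp0.le

omit instK in
/-- The exponent inequality behind the upper inclusion: for `N ≥ 1`, `e ≥ 1` and
`c = ⌊log(p·e/(p−1))/log(p)⌋`, `v_p(N) − N/e ≤ c − 1/e` (if `v_p(N) > c` then
`e·(v_p(N) − c) < p^c (p−1)(v_p(N) − c) ≤ p^{v_p(N)} − 1 ≤ N − 1`).
[claim: Mochizuki2012, status: disputed] -/
theorem padicValNat_sub_le {e : ℕ} (he : 1 ≤ e) {N : ℕ} (hN : N ≠ 0) :
    (padicValNat p N : ℝ) - N / e ≤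
      (⌊Real.log ((p : ℝ) * e / ((p : ℝ) - 1)) / Real.log p⌋ : ℝ) - 1 / e := by
  have hp : p.Prime := Fact.out
  have hp1 : (1 : ℝ) < p := by exact_mod_cast hp.one_lt
  have he0 : (0 : ℝ) < e := by exact_mod_cast he
  set c := ⌊Real.log ((p : ℝ) * e / ((p : ℝ) - 1)) / Real.log p⌋ with hc
  have hc0 : 0 ≤ c := floor_logRadius_nonneg p he
  set k := c.toNat with hk
  have hck : (c : ℝ) = k := by exact_mod_cast (Int.toNat_of_nonneg hc0).symm
  have hek : (e : ℝ) < (p : ℝ) ^ k * ((p : ℝ) - 1) := lt_pow_floor_mul p he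
  set v := padicValNat p N with hv
  -- reduce to `e * (v - k) ≤ N - 1`
  rw [hck]
  have key : (e : ℝ) * ((v : ℝ) - k) ≤ (N : ℝ) - 1 := by
    rcases le_or_gt v k with hvk | hvk
    · have h1 : (e : ℝ) * ((v : ℝ) - k) ≤ 0 :=
        mul_nonpos_of_nonneg_of_nonpos he0.le (by simp only [sub_nonpos]; exact_mod_cast hvk)
      have h2 : (1 : ℝ) ≤ N := by exact_mod_cast Nat.pos_of_ne_zero hN
      linarith
    · -- `v > k`: `N ≥ p^v`, and `p^k (p-1) (v-k) ≤ p^v - p^k ≤ p^v - 1`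
      have hle : p ^ v ≤ N := Nat.le_of_dvd (Nat.pos_of_ne_zero hN) pow_padicValNat_dvd
      have hle' : (p : ℝ) ^ v ≤ N := by exact_mod_cast hle
      obtain ⟨j, hvj⟩ : ∃ j, v = k + j := ⟨v - k, by omega⟩
      have hj : (v : ℝ) - k = j := by rw [hvj]; push_cast; ring
      rw [hj]
      rw [hvj] at hle'
      have hB : 1 + (j : ℝ) * ((p : ℝ) - 1) ≤ (p : ℝ) ^ j := by
        have := one_add_mul_le_pow (show (-2 : ℝ) ≤ (p : ℝ) - 1 by linarith) j
        simpa using this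
      have hpk : (1 : ℝ) ≤ (p : ℝ) ^ k := one_le_pow₀ hp1.le
      have hj0 : (0 : ℝ) ≤ j := by positivity
      calc (e : ℝ) * j ≤ (p : ℝ) ^ k * ((p : ℝ) - 1) * j := by gcongr
        _ = (p : ℝ) ^ k * ((j : ℝ) * ((p : ℝ) - 1)) := by ring
        _ ≤ (p : ℝ) ^ k * ((p : ℝ) ^ j - 1) := by gcongr; linarith
        _ = (p : ℝ) ^ (k + j) - (p : ℝ) ^ k := by rw [pow_add]; ring
        _ ≤ (N : ℝ) - 1 := by linarith
  -- divide by `e`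
  have : ((v : ℝ) - k) - (N - 1) / e ≤ 0 := by
    rw [sub_nonpos, le_div_iff₀ he0]
    linarith
  have hsplit : (v : ℝ) - N / e - ((k : ℝ) - 1 / e) = ((v : ℝ) - k) - (N - 1) / e := by
    field_simp
    ring
  linarith [hsplit]

/-! ## Proof of Proposition 1.2 (i) -/

section Proof

variable [IsUltrametricDist K] [ProperSpace K]

/-- **Lower inclusion `p^a · R ⊆ log_p(R^×)`**: `θ = p^{1/(p−1) − a} < 1` because `a > 1/(p−1)`, so
every `z ∈ p^a·R` is `L(u) = log_p(u)` for a principal unit `u ∈ 1 + p^a·R`.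
[claim: Mochizuki2012, status: disputed] -/
theorem pBall_logRadiusA_subset_logUnits :
    pBall p K (logRadiusA p (absRamificationIdx p K)) ⊆ logUnits K := by
  have hp1 : (1 : ℝ) < p := by exact_mod_cast (Fact.out : p.Prime).one_lt
  have hp0 : (0 : ℝ) < p := by linarith
  set a := logRadiusA p (absRamificationIdx p K) with ha
  have hθ : (p : ℝ) ^ (-a) * (p : ℝ) ^ (1 / ((p : ℝ) - 1)) < 1 := by
    rw [← Real.rpow_add hp0]
    refine Real.rpow_lt_one_of_one_lt_of_neg hp1 ?_
    have := one_div_lt_logRadiusA p (absRamificationIdx_pos p K)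
    linarith
  intro z hz
  rw [mem_pBall_iff] at hz
  obtain ⟨u, hu1, huz⟩ := exists_logSeries_eq p K hθ hz
  have hρ1 : (p : ℝ) ^ (-a) < 1 := by
    refine Real.rpow_lt_one_of_one_lt_of_neg hp1 ?_
    have := one_div_lt_logRadiusA p (absRamificationIdx_pos p K)
    have : 0 < 1 / ((p : ℝ) - 1) := div_pos one_pos (by linarith)
    linarith
  have huP : IsPrincipal u := hu1.trans_lt hρ1
  exact ⟨u, huP.norm_eq_one, by rw [unitLog_of_isPrincipal p huP, huz]⟩

/-- **Upper inclusion `log_p(R^×) ⊆ p^{−b} · R`**: for a unit `u` take `m` prime to `p` with `u^m`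
principal; then `log_p u = m⁻¹·L(u^m)`, `‖m⁻¹‖ = 1`, `‖1 − u^m‖ ≤ p^{−1/e}`, and every term of `L(u^m)`
has norm `≤ p^{v_p(N) − N/e} ≤ p^{b}` (`padicValNat_sub_le`). [claim: Mochizuki2012, status: disputed] -/
theorem logUnits_subset_pBall_neg_logRadiusB :
    logUnits K ⊆ pBall p K (-logRadiusB p (absRamificationIdx p K)) := by
  have hp : p.Prime := Fact.out
  have hp1 : (1 : ℝ) < p := by exact_mod_cast hp.one_lt
  have hp0 : (0 : ℝ) < p := by linarith
  set e := absRamificationIdx p K with he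
  have he1 : 1 ≤ e := absRamificationIdx_pos p K
  have he0 : (0 : ℝ) < e := by exact_mod_cast he1
  rintro _ ⟨u, hu, rfl⟩
  rw [Set.mem_setOf_eq] at hu
  rw [mem_pBall_iff, neg_neg]
  obtain ⟨m, hm, hpm, hmP⟩ := exists_pow_isPrincipal_not_dvd (p := p) hu
  rw [unitLog_eq_inv_mul_logSeries p hm hmP, norm_mul, norm_inv]
  have hm1 : ‖((m : ℕ) : K)‖ = 1 := by
    rw [norm_natCast_eq_padicNorm p K m, Padic.norm_natCast_eq_one_iff]
    exact (Nat.Prime.coprime_iff_not_dvd hp).mpr hpm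
  rw [hm1, inv_one, one_mul]
  -- bound every term of `L(u^m)`
  set y := u ^ m with hy
  have hy1 : ‖1 - y‖ ≤ (p : ℝ) ^ (-(1 / (e : ℝ))) := norm_le_rpow_of_norm_lt_one p K hmP
  refine norm_logSeries_le (by positivity) fun n ↦ ?_
  rw [norm_logTerm_eq p K y n]
  have hN : (n + 1 : ℕ) ≠ 0 := Nat.succ_ne_zero n
  have hexp := padicValNat_sub_le p he1 hN
  calc ‖1 - y‖ ^ (n + 1) * (p : ℝ) ^ padicValNat p (n + 1)
      ≤ ((p : ℝ) ^ (-(1 / (e : ℝ)))) ^ (n + 1) * (p : ℝ) ^ padicValNat p (n + 1) := by gcongr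
    _ = (p : ℝ) ^ ((padicValNat p (n + 1) : ℝ) - ((n + 1 : ℕ) : ℝ) / e) := by
        rw [← Real.rpow_natCast, ← Real.rpow_natCast ((p : ℝ)), ← Real.rpow_mul hp0.le,
          ← Real.rpow_add hp0]
        congr 1
        ring
    _ ≤ (p : ℝ) ^ logRadiusB p e := by
        rw [Real.rpow_le_rpow_left_iff hp1, logRadiusB]
        exact hexp

/-- **`log_p` restricted to `1 + p^a·R` is a bijection onto `p^a·R`** (image statement; with
`logSeries_injOn` this is `log_p : 1 + p^a·R ≅ p^a·R`). [claim: Mochizuki2012, status: disputed] -/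
theorem unitLog_image_eq_pBall :
    unitLog '' {y : K | ‖1 - y‖ ≤ (p : ℝ) ^ (-logRadiusA p (absRamificationIdx p K))} =
      pBall p K (logRadiusA p (absRamificationIdx p K)) := by
  have hp1 : (1 : ℝ) < p := by exact_mod_cast (Fact.out : p.Prime).one_lt
  have hp0 : (0 : ℝ) < p := by linarith
  set a := logRadiusA p (absRamificationIdx p K) with ha
  have hlt := one_div_lt_logRadiusA p (absRamificationIdx_pos p K)
  have hθ : (p : ℝ) ^ (-a) * (p : ℝ) ^ (1 / ((p : ℝ) - 1)) < 1 := by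
    rw [← Real.rpow_add hp0]
    exact Real.rpow_lt_one_of_one_lt_of_neg hp1 (by linarith)
  have hρ1 : (p : ℝ) ^ (-a) < 1 :=
    Real.rpow_lt_one_of_one_lt_of_neg hp1 (by linarith [div_pos one_pos (by linarith : (0:ℝ) < p - 1)])
  have himg : unitLog '' {y : K | ‖1 - y‖ ≤ (p : ℝ) ^ (-a)} =
      logSeries '' {y : K | ‖1 - y‖ ≤ (p : ℝ) ^ (-a)} := by
    refine Set.image_congr fun y hy ↦ ?_
    rw [Set.mem_setOf_eq] at hy
    exact unitLog_of_isPrincipal p (hy.trans_lt hρ1)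
  rw [himg, logSeries_image_closedBall p K hθ]
  rfl

/-- **`log_p` is injective on `1 + p^a·R`.** [claim: Mochizuki2012, status: disputed] -/
theorem unitLog_injOn :
    Set.InjOn (unitLog (K := K)) {y : K | ‖1 - y‖ ≤ (p : ℝ) ^ (-logRadiusA p (absRamificationIdx p K))} := by
  have hp1 : (1 : ℝ) < p := by exact_mod_cast (Fact.out : p.Prime).one_lt
  have hp0 : (0 : ℝ) < p := by linarith
  set a := logRadiusA p (absRamificationIdx p K) with ha
  have hlt := one_div_lt_logRadiusA p (absRamificationIdx_pos p K)
  have hθ : (p : ℝ) ^ (-a) * (p : ℝ) ^ (1 / ((p : ℝ) - 1)) < 1 := by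
    rw [← Real.rpow_add hp0]
    exact Real.rpow_lt_one_of_one_lt_of_neg hp1 (by linarith)
  have hρ1 : (p : ℝ) ^ (-a) < 1 :=
    Real.rpow_lt_one_of_one_lt_of_neg hp1 (by linarith [div_pos one_pos (by linarith : (0:ℝ) < p - 1)])
  intro y₁ hy₁ y₂ hy₂ h
  have h₁ : unitLog y₁ = logSeries y₁ := unitLog_of_isPrincipal p (lt_of_le_of_lt hy₁ hρ1)
  have h₂ : unitLog y₂ = logSeries y₂ := unitLog_of_isPrincipal p (lt_of_le_of_lt hy₂ hρ1)
  rw [h₁, h₂] at h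
  exact logSeries_injOn p K hθ hy₁ hy₂ h

/-- **[IUTchIV] Proposition 1.2 (i) holds.** [claim: Mochizuki2012, status: disputed] -/
theorem prop12i_holds : Prop12i p K :=
  ⟨pBall_logRadiusA_subset_logUnits p K, logUnits_subset_pBall_neg_logRadiusB p K⟩

/-- **[IUTchIV] Proposition 1.2 (i), equality clause, holds**: for `p > 2`, `e ≤ p − 2` one has
`a = 1/e = −b`, so `p^a·R = p^{−b}·R` and both inclusions are equalities
(`log_p(R^×) = p^{1/e}·R = 𝔪_K`). [claim: Mochizuki2012, status: disputed] -/
theorem prop12iEq_holds : Prop12iEq p K := by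
  intro hp he
  have he1 := absRamificationIdx_pos p K
  have hab : logRadiusA p (absRamificationIdx p K) = -logRadiusB p (absRamificationIdx p K) := by
    rw [logRadiusA_eq hp he1 he, logRadiusB_eq hp he1 he, neg_neg]
  obtain ⟨h1, h2⟩ := prop12i_holds p K
  rw [hab] at h1 ⊢
  exact ⟨Set.Subset.antisymm h1 h2, Set.Subset.antisymm h2 h1⟩

end Proof

end Literature.IUT.LogVolume

end
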